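import Summits.ABC.IUTFork.Repair.RHHeightScalingSRMDatum
import Summits.ABC.IUTFork.Repair.RHHeightScaling
import HarnessLib

/-!
# R-H ROUND-3 AXIS D2, class «SRM» — JUNCTION TO THE SHARED VOCABULARY: every SRM datum profile is `PriceBounded` with the
# ∀-certified cap `C₁`, hence `ExponentAtMost (−1) C₁`, `NegExponent`, `¬ DoorAt`

PROOF-ONLY junction (0 definitions, 0 `Prop` facts) of the abc-iut cell, rung LADDER-ABC:A2.RESCUE.H, seat abc-iut-rh2-q2-eq (gen 8), KEY
`D2-EXP-2`; ruling R82 (a) of the AXES C/D desk: «any typed `ExponentAtMost` / `PowerBoundFrom` instance of rows EXP-2 / EXP-4 cites the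
∀ s ≥ 1 CERTIFIED height-free cap `C₁ := Σ_w u_w Σ_{j≥2}(jδ_w + (j+1)G_w + e_w − 1)/M₁`, never the saturated `ĉ`». BY NAME: this seat's
`weighted_srm_le` (p533397: `6·Σ_w u_w SRM_w(m_w) ≤ Σ_w u_w B_w` at ANY depths) composed with abc-iut-rh2-T-1's vocabulary
`RH.HeightScaling.PriceBounded` / `exponentAtMost_neg_one_of_le_const` / `negExponent_of_priceBounded` / `not_doorAt_of_negExponent`
(`Repair/RHHeightScaling.lean`).

THE PROFILE. A datum = finite bad-place set `W`, weights `u_w ≥ 0`, integers `e_w > 0`, `δ_w ≥ 0`, `R_out,w ≤ R_in,w`, common `l⋆ = n+1`,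
bed mass `M₁ > 0` (real). An SRM DATUM PROFILE is any `f : ℝ → ℝ` with `f s = (Σ_w u_w·SRM_w(dep s w))/(s·M₁)` for `s ≥ 1`, where
`dep : ℝ → ι → ℤ` is ANY depth schedule (the dilation `m_w = ⌊s·m₁,w⌋`, `⌈s·m₁,w⌉`, integer `s·m₁,w`, … — the ceiling is depth-free, so the
discretisation of the real dilation is immaterial; this meets the refuters' «residues only» guard uniformly).

WHAT IS PROVED (namespace `Summit.ABC.IUTFork.Repair.RH.HeightScalingSRM`, section `Junction`): `priceBounded_of_srmProfile` (cert
`s ↦ Σ_w u_w SRM_w(dep s w)`, `P̄ = (Σ_w u_w B_w)/6`); **`exponentAtMost_of_srmProfile`** «`ExponentAtMost f (−1) ((Σ_w u_w B_w)/6/M₁)`» — the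
constant IS `C₁` (`6M₁·C₁ = Σ u B`); `negExponent_of_srmProfile`; **`not_doorAt_of_srmProfile`** (the SRM class opens NO door at conjugate
fibres — scope words of R82 (e): the integers are those of the conjugate-fibre cell; every fibre of FREY133 / HEX79 / FREY482).
HONEST FRAMING: bookkeeping composition of landed theorems; nothing here decides any cell at genuine data, asserts or denies [IUTchIII]
Cor. 3.12 / [IUTchIV] Thm 1.10, or bears on abc; no side taken on any author; typed ≠ proved. [cite: DupuyHilado2025, §4.12]
[claim: Mochizuki2012, status: disputed] for every quoted construction.
-/

namespace Summit.ABC.IUTFork.Repair.RH.HeightScalingSRM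

open Summit.ABC.IUTFork.Repair.RH.HeightScaling

/-! ## §6. Junction: SRM datum profiles are price-bounded with the certified cap `C₁` -/

section Junction

variable {ι : Type*} (W : Finset ι) (u : ι → ℝ) (e δ Rin Rout : ι → ℤ)

/-- **An SRM datum profile is `PriceBounded M₁`** with certificate `s ↦ Σ_w u_w·SRM_w(dep s w)` and the HEIGHT-FREE bound
`P̄ = (Σ_w u_w·B_w)/6`, `B_w = 3n(n+3)δ_w + 3n(n+5)G_w + 6n(e_w − 1)` (`weighted_srm_le` at the depths `dep s`), for ANY depth schedule `dep`.
[cite: DupuyHilado2025, §4.12] [claim: Mochizuki2012, status: disputed] -/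
theorem priceBounded_of_srmProfile (hu : ∀ w ∈ W, 0 ≤ u w) (he : ∀ w ∈ W, 0 < e w) (hδ : ∀ w ∈ W, 0 ≤ δ w)
    (hio : ∀ w ∈ W, Rout w ≤ Rin w) (n : ℕ) (M₁ : ℝ) (dep : ℝ → ι → ℤ) (f : ℝ → ℝ)
    (hf : ∀ s : ℝ, 1 ≤ s → f s = (∑ w ∈ W, u w * (((∑ k ∈ Finset.range (n + 1),
          (if 0 < e w * ((((k : ℤ) + 1) ^ 2 * dep s w - ((k : ℤ) + 1) * δ w - ((k : ℤ) + 1 + 1) * Rin w) / e w) + ((k : ℤ) + 1 + 1) * Rout w - dep s w then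
            (((k : ℤ) + 1) ^ 2 - 1) * dep s w -
              (e w * ((((k : ℤ) + 1) ^ 2 * dep s w - ((k : ℤ) + 1) * δ w - ((k : ℤ) + 1 + 1) * Rin w) / e w) + ((k : ℤ) + 1 + 1) * Rout w - dep s w)
          else 0)) : ℤ) : ℝ)) / (s * M₁)) :
    PriceBounded M₁ f := by
  refine ⟨fun s => ∑ w ∈ W, u w * (((∑ k ∈ Finset.range (n + 1),
          (if 0 < e w * ((((k : ℤ) + 1) ^ 2 * dep s w - ((k : ℤ) + 1) * δ w - ((k : ℤ) + 1 + 1) * Rin w) / e w) + ((k : ℤ) + 1 + 1) * Rout w - dep s w then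
            (((k : ℤ) + 1) ^ 2 - 1) * dep s w -
              (e w * ((((k : ℤ) + 1) ^ 2 * dep s w - ((k : ℤ) + 1) * δ w - ((k : ℤ) + 1 + 1) * Rin w) / e w) + ((k : ℤ) + 1 + 1) * Rout w - dep s w)
          else 0)) : ℤ) : ℝ),
    (∑ w ∈ W, u w * (((3 * (n : ℤ) * (n + 3) * δ w + 3 * (n : ℤ) * (n + 5) * (Rin w - Rout w) + 6 * (n : ℤ) * (e w - 1)) : ℤ) : ℝ)) / 6, ?_, hf⟩
  intro s _
  have h := weighted_srm_le W u e δ Rin Rout hu he hδ hio (dep s) n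
  rw [le_div_iff₀ (by norm_num : (0 : ℝ) < 6)]
  linarith

/-- **`ExponentAtMost f (−1) C₁`** for every SRM datum profile: `f s ≤ C₁·s⁻¹` at every real dilation `s ≥ 1`, with
`C₁ = (Σ_w u_w·B_w)/6/M₁` — R82 (a)'s ∀-CERTIFIED cap (bed lower-medians 1.798 FREY133 · 3.854 HEX79 · 2.000 FREY482; pooled 1.918 · 3.750 · 2.016),
NOT the saturated `ĉ`. [cite: DupuyHilado2025, §4.12] [claim: Mochizuki2012, status: disputed] -/
theorem exponentAtMost_of_srmProfile (hu : ∀ w ∈ W, 0 ≤ u w) (he : ∀ w ∈ W, 0 < e w) (hδ : ∀ w ∈ W, 0 ≤ δ w)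
    (hio : ∀ w ∈ W, Rout w ≤ Rin w) (n : ℕ) {M₁ : ℝ} (hM : 0 < M₁) (dep : ℝ → ι → ℤ) (f : ℝ → ℝ)
    (hf : ∀ s : ℝ, 1 ≤ s → f s = (∑ w ∈ W, u w * (((∑ k ∈ Finset.range (n + 1),
          (if 0 < e w * ((((k : ℤ) + 1) ^ 2 * dep s w - ((k : ℤ) + 1) * δ w - ((k : ℤ) + 1 + 1) * Rin w) / e w) + ((k : ℤ) + 1 + 1) * Rout w - dep s w then
            (((k : ℤ) + 1) ^ 2 - 1) * dep s w -
              (e w * ((((k : ℤ) + 1) ^ 2 * dep s w - ((k : ℤ) + 1) * δ w - ((k : ℤ) + 1 + 1) * Rin w) / e w) + ((k : ℤ) + 1 + 1) * Rout w - dep s w)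
          else 0)) : ℤ) : ℝ)) / (s * M₁)) :
    ExponentAtMost f (-1) ((∑ w ∈ W, u w * (((3 * (n : ℤ) * (n + 3) * δ w + 3 * (n : ℤ) * (n + 5) * (Rin w - Rout w) + 6 * (n : ℤ) * (e w - 1)) : ℤ) : ℝ)) / 6 / M₁) := by
  intro s hs
  rw [hf s hs]
  have hP : ∀ s : ℝ, 1 ≤ s → (∑ w ∈ W, u w * (((∑ k ∈ Finset.range (n + 1),
          (if 0 < e w * ((((k : ℤ) + 1) ^ 2 * dep s w - ((k : ℤ) + 1) * δ w - ((k : ℤ) + 1 + 1) * Rin w) / e w) + ((k : ℤ) + 1 + 1) * Rout w - dep s w then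
            (((k : ℤ) + 1) ^ 2 - 1) * dep s w -
              (e w * ((((k : ℤ) + 1) ^ 2 * dep s w - ((k : ℤ) + 1) * δ w - ((k : ℤ) + 1 + 1) * Rin w) / e w) + ((k : ℤ) + 1 + 1) * Rout w - dep s w)
          else 0)) : ℤ) : ℝ))
      ≤ (∑ w ∈ W, u w * (((3 * (n : ℤ) * (n + 3) * δ w + 3 * (n : ℤ) * (n + 5) * (Rin w - Rout w) + 6 * (n : ℤ) * (e w - 1)) : ℤ) : ℝ)) / 6 := by
    intro s _
    have h := weighted_srm_le W u e δ Rin Rout hu he hδ hio (dep s) n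
    rw [le_div_iff₀ (by norm_num : (0 : ℝ) < 6)]
    linarith
  exact exponentAtMost_neg_one_of_le_const hM hP s hs

/-- **`NegExponent f`** for every SRM datum profile (`M₁ > 0`). [cite: DupuyHilado2025, §4.12] [claim: Mochizuki2012, status: disputed] -/
theorem negExponent_of_srmProfile (hu : ∀ w ∈ W, 0 ≤ u w) (he : ∀ w ∈ W, 0 < e w) (hδ : ∀ w ∈ W, 0 ≤ δ w)
    (hio : ∀ w ∈ W, Rout w ≤ Rin w) (n : ℕ) {M₁ : ℝ} (hM : 0 < M₁) (dep : ℝ → ι → ℤ) (f : ℝ → ℝ)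
    (hf : ∀ s : ℝ, 1 ≤ s → f s = (∑ w ∈ W, u w * (((∑ k ∈ Finset.range (n + 1),
          (if 0 < e w * ((((k : ℤ) + 1) ^ 2 * dep s w - ((k : ℤ) + 1) * δ w - ((k : ℤ) + 1 + 1) * Rin w) / e w) + ((k : ℤ) + 1 + 1) * Rout w - dep s w then
            (((k : ℤ) + 1) ^ 2 - 1) * dep s w -
              (e w * ((((k : ℤ) + 1) ^ 2 * dep s w - ((k : ℤ) + 1) * δ w - ((k : ℤ) + 1 + 1) * Rin w) / e w) + ((k : ℤ) + 1 + 1) * Rout w - dep s w)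
          else 0)) : ℤ) : ℝ)) / (s * M₁)) :
    NegExponent f :=
  negExponent_of_priceBounded hM (priceBounded_of_srmProfile W u e δ Rin Rout hu he hδ hio n M₁ dep f hf)

/-- **THE SRM CLASS OPENS NO DOOR**: no SRM datum profile stays above a positive constant at every height (`¬ DoorAt f`; conjugate-fibre
integers — every fibre of the tabulated beds; scope words R82 (e)). [cite: DupuyHilado2025, §4.12] [claim: Mochizuki2012, status: disputed] -/
theorem not_doorAt_of_srmProfile (hu : ∀ w ∈ W, 0 ≤ u w) (he : ∀ w ∈ W, 0 < e w) (hδ : ∀ w ∈ W, 0 ≤ δ w)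
    (hio : ∀ w ∈ W, Rout w ≤ Rin w) (n : ℕ) {M₁ : ℝ} (hM : 0 < M₁) (dep : ℝ → ι → ℤ) (f : ℝ → ℝ)
    (hf : ∀ s : ℝ, 1 ≤ s → f s = (∑ w ∈ W, u w * (((∑ k ∈ Finset.range (n + 1),
          (if 0 < e w * ((((k : ℤ) + 1) ^ 2 * dep s w - ((k : ℤ) + 1) * δ w - ((k : ℤ) + 1 + 1) * Rin w) / e w) + ((k : ℤ) + 1 + 1) * Rout w - dep s w then
            (((k : ℤ) + 1) ^ 2 - 1) * dep s w -
              (e w * ((((k : ℤ) + 1) ^ 2 * dep s w - ((k : ℤ) + 1) * δ w - ((k : ℤ) + 1 + 1) * Rin w) / e w) + ((k : ℤ) + 1 + 1) * Rout w - dep s w)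
          else 0)) : ℤ) : ℝ)) / (s * M₁)) :
    ¬ DoorAt f :=
  not_doorAt_of_negExponent (negExponent_of_srmProfile W u e δ Rin Rout hu he hδ hio n hM dep f hf)

end Junction

end Summit.ABC.IUTFork.Repair.RH.HeightScalingSRM
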